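import Summits.SmoothPoincare4.SmoothPoincare4.Theorems.ConvexBisectionAcyclicBisectionExistsHgapTwistWind
import Literature.Topology.FourManifolds.TorusCoordinates
import Literature.Topology.FourManifolds.GluckTwistMeridian
import HarnessLib

/-!
# N1 ▸ `node_N1_move` ▸ (d) N1-mono ▸ piece (d9), brick J2-1: REFLECTING A VECTOR IN A HALF-TURN OF LINES
(wave 8, crux stmt-SmoothPoincare4-10508, line `modp-braid-orbits`, registered stub `stub_M2geo` (N1) ▸
`node_N1_move` ▸ sub-node (d) `helper_N1_beltMonodromy` ▸ piece (d9); registered sub-goal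
`helper_wind_reflect_halfTurn`; continued by `…BeltReturnLinear.lean` = brick J2-2, `helper_linearBeltReturn_integer`)

Piece (d9) of H4-REPORT §4 is the Picard–Lefschetz integer `n₀ = ±1` of the return map `G` of the (d) statement.
On the LINEAR MODEL (brick J2-2) the return map is a REFLECTION of the core angle `v` in the lines `(M m')^⊥` as the
fibre vector `m'` runs along a chart line, i.e. its direction makes a half-turn; this file is the plane algebra and
plane topology of that picture:

* §1 `ℝ² = ℂ` in coordinates (`eq_smul_single_add`), the reflection
  `refl_w v := v - (2⟪w, v⟫/‖w‖²) • w` in the line `w^⊥`: `toC (refl_w v) = - v̄ w / w̄` (`toC_reflectLine`), it reverses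
  the `w`-component, preserves norms, is linear, only depends on the line, fixes `w^⊥`;
* §2 **`wind_reflect_of_odd`**: for a continuous nowhere-zero `g` with `g (t + 1/2) = - g t` and `z ≠ 0` the loop
  `s ↦ refl_{g (s/2)} z = - z̄ g (s/2) / conj (g (s/2))`, `s ∈ [0, 1]`, winds `wind g` times (a logarithm `l` of `g`
  has `l (1/2) - l 0 = (l 1 - l 0)/2 = πi · wind g` by uniqueness of logarithms, and `l - l̄` is a logarithm of
  `g/ḡ`); registered **`helper_wind_reflect_halfTurn`**: for `g = M e^{2πit}`, `M = [[a, b], [c, d]]`, the count is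
  `sign det M` (G2's `wind_linearLoop`);
* §3 `2 × 2` matrices as continuous linear maps of `EuclideanSpace ℝ (Fin 2)` (the type of H4's belt matrix): the
  linear loop in entries (`toC_clm_circlePt`), `det ≠ 0` for injective maps, `wind = sign det` (`wind_clm_circlePt`).
Everything is proved; no named facts, no `sorry`.  References: W. Fulton, *Algebraic Topology: A First Course*
(1995), §3 [Fulton1995]; R. E. Gompf, A. I. Stipsicz, *4-Manifolds and Kirby Calculus* (1999), §8.2 [GompfStipsicz1999].
-/

noncomputable section

set_option linter.dupNamespace false

open scoped Manifold ContDiff Topology ComplexConjugate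
open Set Function Complex Filter
open Literature.Topology.FourManifolds Literature.Topology.PlaneTopology Literature.Geometry.Symplectic

namespace Summit.SmoothPoincare4.SmoothPoincare4.Theorems.AcyclicBisectionExists.ModpBraidOrbits

/-! ## §1 Plane algebra: `ℝ² ↔ ℂ` and the reflection in a line -/

/-- A vector of `ℝ²` in the standard basis. [folklore] -/
theorem eq_smul_single_add (x : EuclideanSpace ℝ (Fin 2)) :
    x = x 0 • EuclideanSpace.single 0 1 + x 1 • EuclideanSpace.single 1 1 := by
  ext i
  fin_cases i <;> simp

/-- **The reflection of `v` in the line `w^⊥` is `-v̄ w / w̄`** (`ℝ² = ℂ`):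
`v - (2⟪w, v⟫/‖w‖²) w = - v̄ · w / w̄`. [folklore] -/
theorem toC_reflectLine {w : EuclideanSpace ℝ (Fin 2)} (hw : w ≠ 0) (v : EuclideanSpace ℝ (Fin 2)) :
    toC (v - (2 * inner ℝ w v / ‖w‖ ^ 2) • w) = -conj (toC v) * toC w / conj (toC w) := by
  have hc : conj (toC w) ≠ 0 := (map_ne_zero _).2 (PlaneComplex.toC_ne_zero hw)
  have hi : inner ℝ w v = w 0 * v 0 + w 1 * v 1 := by
    rw [real_inner_comm]
    simp [PiLp.inner_apply, Fin.sum_univ_two]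
  have hns : ‖w‖ ^ 2 = w 0 ^ 2 + w 1 ^ 2 := by
    rw [EuclideanSpace.norm_eq, Real.sq_sqrt (by positivity)]
    simp [Fin.sum_univ_two]
  have hn : w 0 ^ 2 + w 1 ^ 2 ≠ 0 := by
    rw [← hns]; exact pow_ne_zero _ (norm_ne_zero_iff.2 hw)
  rw [eq_div_iff hc, hi, hns]
  apply Complex.ext
  · simp [toC]
    field_simp
    ring
  · simp [toC]
    field_simp
    ring

/-- The reflection in `w^⊥` reverses the `w`-component: `⟪w, refl_w m⟫ = -⟪w, m⟫`. [folklore] -/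
theorem inner_reflectLine {w : EuclideanSpace ℝ (Fin 2)} (hw : w ≠ 0) (m : EuclideanSpace ℝ (Fin 2)) :
    inner ℝ w (m - (2 * inner ℝ w m / ‖w‖ ^ 2) • w) = -inner ℝ w m := by
  have hn : ‖w‖ ^ 2 ≠ 0 := pow_ne_zero _ (norm_ne_zero_iff.2 hw)
  rw [inner_sub_right, real_inner_smul_right, real_inner_self_eq_norm_sq]
  field_simp
  ring

/-- The reflection in `w^⊥` preserves the norm. [folklore] -/
theorem norm_reflectLine {w : EuclideanSpace ℝ (Fin 2)} (hw : w ≠ 0) (m : EuclideanSpace ℝ (Fin 2)) :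
    ‖m - (2 * inner ℝ w m / ‖w‖ ^ 2) • w‖ = ‖m‖ := by
  have h := toC_reflectLine hw m
  rw [← norm_toC, h, norm_div, norm_mul, norm_neg, Complex.norm_conj, Complex.norm_conj,
    mul_div_assoc, div_self (norm_ne_zero_iff.2 (PlaneComplex.toC_ne_zero hw)), mul_one, norm_toC]

/-- The reflection is linear in the reflected vector: `refl_w (r • m) = r • refl_w m`. [folklore] -/
theorem reflectLine_smul (w : EuclideanSpace ℝ (Fin 2)) (r : ℝ) (m : EuclideanSpace ℝ (Fin 2)) :
    r • m - (2 * inner ℝ w (r • m) / ‖w‖ ^ 2) • w = r • (m - (2 * inner ℝ w m / ‖w‖ ^ 2) • w) := by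
  rw [real_inner_smul_right, smul_sub, smul_smul]
  congr 1
  ring_nf

/-- The reflection only depends on the line: `refl_{c w} = refl_w` for `c ≠ 0`. [folklore] -/
theorem reflectLine_line {c : ℝ} (hc : c ≠ 0) (w m : EuclideanSpace ℝ (Fin 2)) :
    m - (2 * inner ℝ (c • w) m / ‖c • w‖ ^ 2) • (c • w) = m - (2 * inner ℝ w m / ‖w‖ ^ 2) • w := by
  by_cases hw : w = 0
  · simp [hw]
  have hn : ‖w‖ ^ 2 ≠ 0 := pow_ne_zero _ (norm_ne_zero_iff.2 hw)
  rw [real_inner_smul_left, norm_smul, mul_pow, Real.norm_eq_abs, sq_abs, smul_smul]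
  congr 1
  field_simp

/-- A vector on the line `w^⊥` is fixed: `⟪w, v⟫ = 0 → refl_w v = v`. [folklore] -/
theorem reflectLine_of_inner_eq_zero {w v : EuclideanSpace ℝ (Fin 2)} (h : inner ℝ w v = 0) :
    v - (2 * inner ℝ w v / ‖w‖ ^ 2) • w = v := by
  rw [h, mul_zero, zero_div, zero_smul, sub_zero]

/-! ## §2 Plane topology: the reflected vector along an odd loop of lines -/

/-- **Reflecting a fixed vector in a half-turn of lines makes it wind as often as the full loop of normals**:
for a continuous nowhere-zero `g` with `g (t + 1/2) = - g t` and `z ≠ 0`, the loop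
`s ↦ refl_{g (s/2)} z = - z̄ · g (s/2) / conj (g (s/2))`, `s ∈ [0, 1]`, has winding number `wind g`
(a logarithm `l` of `g` has `l (1/2) - l 0 = (l 1 - l 0)/2 = πi · wind g`, and `l - l̄` is a logarithm of
`g / ḡ`). [cite: Fulton1995, §3] -/
theorem wind_reflect_of_odd {g : ℝ → ℂ} (hg : Continuous g) (hne : ∀ t, g t ≠ 0)
    (hodd : ∀ t, g (t + 1 / 2) = -g t) {z : ℂ} (hz : z ≠ 0) :
    wind (fun s => -conj z * g (s / 2) / conj (g (s / 2))) = wind g := by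
  have hhalf0 : g (1 / 2) = -g 0 := by simpa using hodd 0
  have h10 : g 0 = g 1 := by
    have h := hodd (1 / 2)
    rw [show (1 / 2 : ℝ) + 1 / 2 = 1 by norm_num, hhalf0, neg_neg] at h
    exact h.symm
  obtain ⟨l, hl, hle⟩ := hasLogOn_Icc (a := 0) (b := 1) hg.continuousOn (fun t _ => hne t)
  have hwg := wind_spec hl hle h10
  -- the symmetry `l (t + 1/2) = l t + πi + 2πi n` on `[0, 1/2]`
  obtain ⟨n, hn⟩ := exists_int_eq_add_of_exp_eq (s := Icc (0 : ℝ) (1 / 2)) isPreconnected_Icc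
    (l := fun t => l (t + 1 / 2)) (m := fun t => l t + Real.pi * I)
    (hl.comp (continuous_id.add continuous_const).continuousOn fun t ht =>
      ⟨by linarith [ht.1], by linarith [ht.2]⟩)
    ((hl.mono (Icc_subset_Icc le_rfl (by norm_num))).add continuousOn_const)
    (fun t ht => by
      rw [Complex.exp_add, Complex.exp_pi_mul_I, hle _ ⟨by linarith [ht.1], by linarith [ht.2]⟩, hodd,
        hle _ ⟨ht.1, by linarith [ht.2]⟩, mul_neg_one])
  have h0 := hn 0 ⟨le_rfl, by norm_num⟩
  have h1 := hn (1 / 2) ⟨by norm_num, le_rfl⟩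
  simp only [zero_add] at h0
  rw [show (1 / 2 : ℝ) + 1 / 2 = 1 by norm_num] at h1
  have hd : l (1 / 2) - l 0 = (wind g : ℂ) * (Real.pi * I) := by
    have h2 : l 1 - l 0 = 2 * (l (1 / 2) - l 0) := by rw [h1, h0]; ring
    rw [h2] at hwg
    linear_combination hwg / 2
  -- a logarithm of the reflected loop
  have hcz : -conj z ≠ 0 := neg_ne_zero.2 ((map_ne_zero _).2 hz)
  set L : ℝ → ℂ := fun s => Complex.log (-conj z) + (l (s / 2) - conj (l (s / 2))) with hL
  have hmaps : MapsTo (fun s : ℝ => s / 2) (Icc (0 : ℝ) 1) (Icc (0 : ℝ) 1) := fun s hs =>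
    ⟨by linarith [hs.1], by linarith [hs.2]⟩
  have hl2 : ContinuousOn (fun s : ℝ => l (s / 2)) (Icc 0 1) :=
    hl.comp (continuous_id.div_const _).continuousOn hmaps
  have hLc : ContinuousOn L (Icc 0 1) :=
    continuousOn_const.add (hl2.sub (Complex.continuous_conj.comp_continuousOn hl2))
  have hLe : ∀ s ∈ Icc (0 : ℝ) 1, exp (L s) = -conj z * g (s / 2) / conj (g (s / 2)) := by
    intro s hs
    rw [hL]
    dsimp only
    rw [Complex.exp_add, Complex.exp_log hcz, Complex.exp_sub, Complex.exp_conj, hle _ (hmaps hs),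
      mul_div_assoc]
  have hf01 : -conj z * g (0 / 2) / conj (g (0 / 2)) = -conj z * g (1 / 2) / conj (g (1 / 2)) := by
    rw [zero_div, hhalf0, map_neg, mul_neg, neg_div_neg_eq]
  have hwf := wind_spec hLc hLe hf01
  apply int_eq_of_mul_two_pi_I_eq
  rw [← hwf, hL]
  dsimp only
  rw [zero_div, show Complex.log (-conj z) + (l (1 / 2) - conj (l (1 / 2))) -
      (Complex.log (-conj z) + (l 0 - conj (l 0))) = (l (1 / 2) - l 0) - conj (l (1 / 2) - l 0) by
    rw [map_sub]; ring, hd]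
  simp only [map_mul, map_intCast, Complex.conj_ofReal, Complex.conj_I]
  ring

/-- The linear loop `t ↦ M e^{2πit}`, `M = [[a, b], [c, d]]` with `det M ≠ 0`, never vanishes. [folklore] -/
theorem linearLoop_ne_zero {a b c d : ℝ} (hdet : a * d - b * c ≠ 0) (t : ℝ) :
    (⟨a * Real.cos (2 * Real.pi * t) + b * Real.sin (2 * Real.pi * t),
      c * Real.cos (2 * Real.pi * t) + d * Real.sin (2 * Real.pi * t)⟩ : ℂ) ≠ 0 := by
  intro h0
  have h1 : a * Real.cos (2 * Real.pi * t) + b * Real.sin (2 * Real.pi * t) = 0 := congrArg Complex.re h0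
  have h2 : c * Real.cos (2 * Real.pi * t) + d * Real.sin (2 * Real.pi * t) = 0 := congrArg Complex.im h0
  have hC : (a * d - b * c) * Real.cos (2 * Real.pi * t) = 0 := by linear_combination d * h1 - b * h2
  have hS : (a * d - b * c) * Real.sin (2 * Real.pi * t) = 0 := by linear_combination -c * h1 + a * h2
  have hC' : Real.cos (2 * Real.pi * t) = 0 := (mul_eq_zero.1 hC).resolve_left hdet
  have hS' : Real.sin (2 * Real.pi * t) = 0 := (mul_eq_zero.1 hS).resolve_left hdet
  have := Real.cos_sq_add_sin_sq (2 * Real.pi * t)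
  rw [hC', hS'] at this
  norm_num at this

/-- **The half-turn of a linear loop**: reflecting `z ≠ 0` in the lines `(M u(s))^⊥`, `u (s) = e^{iπs}`,
`s ∈ [0, 1]`, gives a loop of winding number `sign det M` (`M = [[a, b], [c, d]]`). [cite: Fulton1995, §3] -/
theorem helper_wind_reflect_halfTurn : ∀ (a b c d : ℝ) (σ : ℤ), (σ = 1 ∨ σ = -1) → 0 < (σ : ℝ) * (a * d - b * c) → ∀ (z : ℂ), z ≠ 0 → Literature.Topology.PlaneTopology.wind (fun s : ℝ => -(starRingEnd ℂ) z * (⟨a * Real.cos (2 * Real.pi * (s / 2)) + b * Real.sin (2 * Real.pi * (s / 2)), c * Real.cos (2 * Real.pi * (s / 2)) + d * Real.sin (2 * Real.pi * (s / 2))⟩ : ℂ) / (starRingEnd ℂ) (⟨a * Real.cos (2 * Real.pi * (s / 2)) + b * Real.sin (2 * Real.pi * (s / 2)), c * Real.cos (2 * Real.pi * (s / 2)) + d * Real.sin (2 * Real.pi * (s / 2))⟩ : ℂ)) = σ := by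
  intro a b c d σ hσ hdet z hz
  have hdet0 : a * d - b * c ≠ 0 := by
    intro h0; rw [h0, mul_zero] at hdet; exact lt_irrefl _ hdet
  have key := wind_reflect_of_odd (z := z)
    (g := fun t => (⟨a * Real.cos (2 * Real.pi * t) + b * Real.sin (2 * Real.pi * t),
      c * Real.cos (2 * Real.pi * t) + d * Real.sin (2 * Real.pi * t)⟩ : ℂ))
    (continuous_complex_mk (by fun_prop) (by fun_prop)) (linearLoop_ne_zero hdet0) ?_ hz
  · rw [key, wind_linearLoop hσ hdet]
  · intro t
    have e : 2 * Real.pi * (t + 1 / 2) = 2 * Real.pi * t + Real.pi := by ring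
    apply Complex.ext
    · simp only [e, Real.cos_add_pi, Real.sin_add_pi, Complex.neg_re]; ring
    · simp only [e, Real.cos_add_pi, Real.sin_add_pi, Complex.neg_im]; ring

/-! ## §3 `2 × 2` matrices on `EuclideanSpace ℝ (Fin 2)`: linear loops, determinant, winding -/

/-- The linear loop of a `2 × 2` matrix `M` on `ℝ²`, in entries: `toC (M e^{2πit}) = (a cos + b sin, c cos + d sin)`,
`a = (M e₀)₀`, `b = (M e₁)₀`, `c = (M e₀)₁`, `d = (M e₁)₁`. [folklore] -/
theorem toC_clm_circlePt (M : EuclideanSpace ℝ (Fin 2) →L[ℝ] EuclideanSpace ℝ (Fin 2)) (t : ℝ) :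
    toC (M (circlePt t : EuclideanSpace ℝ (Fin 2))) =
      (⟨M (EuclideanSpace.single 0 1) 0 * Real.cos (2 * Real.pi * t) +
          M (EuclideanSpace.single 1 1) 0 * Real.sin (2 * Real.pi * t),
        M (EuclideanSpace.single 0 1) 1 * Real.cos (2 * Real.pi * t) +
          M (EuclideanSpace.single 1 1) 1 * Real.sin (2 * Real.pi * t)⟩ : ℂ) := by
  have e : (circlePt t : EuclideanSpace ℝ (Fin 2)) =
      Real.cos (2 * Real.pi * t) • EuclideanSpace.single 0 1 +
        Real.sin (2 * Real.pi * t) • EuclideanSpace.single 1 1 := by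
    conv_lhs => rw [eq_smul_single_add (circlePt t : EuclideanSpace ℝ (Fin 2))]
    rw [circlePt_apply_zero, circlePt_apply_one]
  rw [e, map_add, map_smul, map_smul]
  apply Complex.ext <;> simp [toC] <;> ring

/-- **An injective `2 × 2` matrix has non-zero determinant** (entries form). [folklore] -/
theorem det_entries_ne_zero_of_injective {M : EuclideanSpace ℝ (Fin 2) →L[ℝ] EuclideanSpace ℝ (Fin 2)}
    (hM : Injective M) :
    M (EuclideanSpace.single 0 1) 0 * M (EuclideanSpace.single 1 1) 1 -
      M (EuclideanSpace.single 1 1) 0 * M (EuclideanSpace.single 0 1) 1 ≠ 0 := by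
  have hne : ∀ t : ℝ, M (circlePt t : EuclideanSpace ℝ (Fin 2)) ≠ 0 := by
    intro t h0
    have h1 : (circlePt t : EuclideanSpace ℝ (Fin 2)) = 0 := hM (by rw [h0, map_zero])
    have := norm_eq_of_mem_sphere (circlePt t)
    rw [h1, norm_zero] at this
    exact zero_ne_one this
  have key := det_ne_zero_of_linearLoop_ne_zero (a := M (EuclideanSpace.single 0 1) 0)
    (b := M (EuclideanSpace.single 1 1) 0) (c := M (EuclideanSpace.single 0 1) 1)
    (d := M (EuclideanSpace.single 1 1) 1) (fun t h0 => hne t (by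
      have h1 := congrArg Prod.fst h0
      have h2 := congrArg Prod.snd h0
      have h : toC (M (circlePt t : EuclideanSpace ℝ (Fin 2))) = 0 := by
        rw [toC_clm_circlePt M t]; exact Complex.ext h1 h2
      exact norm_eq_zero.1 (by rw [← norm_toC, h, norm_zero])))
  intro h0
  exact key (by linear_combination h0)

/-- **The winding number of the linear loop of `M` is `sign det M`** (entries form; G2's `wind_linearLoop`).
[cite: Fulton1995, §3] -/
theorem wind_clm_circlePt (M : EuclideanSpace ℝ (Fin 2) →L[ℝ] EuclideanSpace ℝ (Fin 2)) {σ : ℤ}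
    (hσ : σ = 1 ∨ σ = -1)
    (hdet : 0 < (σ : ℝ) * (M (EuclideanSpace.single 0 1) 0 * M (EuclideanSpace.single 1 1) 1 -
      M (EuclideanSpace.single 1 1) 0 * M (EuclideanSpace.single 0 1) 1)) :
    wind (fun t => toC (M (circlePt t : EuclideanSpace ℝ (Fin 2)))) = σ := by
  simp_rw [toC_clm_circlePt]
  exact wind_linearLoop hσ hdet

end Summit.SmoothPoincare4.SmoothPoincare4.Theorems.AcyclicBisectionExists.ModpBraidOrbits

end
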